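/-
Copyright (c) 2026. All rights reserved.
Released under Apache 2.0 license as described in the file LICENSE.
Authors: abc-iut cell, wave-2 seat abc-iut-L3-t11 (proof-only; G31 conjunct (4) assembly over
`Commensurability.lean` v3, ruling γ2).
-/
import Literature.AnabelianGeometry.SemiGraphs.SurfaceTypeEstranged
import HarnessLib

/-!
# [SemiAnbd] Example 2.10, conjunct (4): assembly to `IsTotallyEstranged`

Mochizuki, *Semi-graphs of anabelioids*, Publ. RIMS **42** (2006) [MochizukiSemiAnbd2006], Example 2.10
p. 31, "totally estranged". PROOF-ONLY assembly of the two clauses proved in `SurfaceTypeEstranged.lean`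
(`branchSubgroup_inf_smul_eq_bot_of_ne`, `branchSubgroup_inf_smul_self_eq_bot`) into abc-iut-L3-t1's
`IsTotallyEstranged` — the edge intersection condition of Def. 2.4 (iv) with representatives ranging over
BASEPOINTS (fibre functors) of the edge anabelioids (`Commensurability.lean` v3, tree-health ruling γ2).
The result is conditional exactly on the named fact `ProSigmaCuspInertiaMalnormal`.
-/

namespace Literature.AnabelianGeometry.SemiGraphs

open CategoryTheory PreGaloisCategory

universe v₁ u₁ u

namespace SemiGraphOfAnabelioids

/-- **[SemiAnbd] Example 2.10, conjunct (4), PROVED from `ProSigmaCuspInertiaMalnormal`**: a semi-graph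
of anabelioids of surface type is totally estranged. [cite: MochizukiSemiAnbd2006, Ex. 2.10 p.31] -/
theorem example_2_10_totallyEstranged_of (hM : ProSigmaCuspInertiaMalnormal.{max u₁ v₁})
    (𝒢 : SemiGraphOfAnabelioids.{v₁, u₁, u}) (Sigma : Set ℕ) (hS : 𝒢.IsOfSurfaceType Sigma) :
    𝒢.IsTotallyEstranged := by
  refine ⟨fun e => ?_⟩
  intro b _ v h F _ Fe _ α
  exact ⟨fun b' h' Fe' _ α' x hne =>
      𝒢.branchSubgroup_inf_smul_eq_bot_of_ne hM hS F h Fe α h' Fe' α' x hne,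
    fun x hx => 𝒢.branchSubgroup_inf_smul_self_eq_bot hM hS F h Fe α x hx⟩

/-- The same as an implication between the named facts' shapes. [cite: MochizukiSemiAnbd2006, Ex. 2.10 p.31] -/
theorem isTotallyEstranged_of_isOfSurfaceType (hM : ProSigmaCuspInertiaMalnormal.{max u₁ v₁}) :
    ∀ (𝒢 : SemiGraphOfAnabelioids.{v₁, u₁, u}) (Sigma : Set ℕ), 𝒢.IsOfSurfaceType Sigma →
      𝒢.IsTotallyEstranged :=
  fun 𝒢 Sigma hS => example_2_10_totallyEstranged_of hM 𝒢 Sigma hS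

end SemiGraphOfAnabelioids

end Literature.AnabelianGeometry.SemiGraphs
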